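import Summits.Ventures.HodgeRepro2.T5SU11MeasurePreserving

/-!
# The half-plane model: `(n_s a_t)·0 = (w - 1)/(w + 1)` with `w = e^{2t} - 2is`, and the hyperbolic area `dx dy / (4 x²)` of the right half-plane is carried to the Poincaré measure

The Iwasawa coordinates `ζ = s + i t` of the disc factor through the RIGHT HALF-PLANE
`{Re w > 0}`: `(n_s a_t)·0 = cayleyDisc (w(ζ))` with `w(ζ) = e^{2t} - 2is` (`T5SU11IwasawaHaar`). The map
`ζ ↦ w(ζ)` is a bijection `ℂ → {Re w > 0}` (`iwasawaHalf_injective`, `iwasawaHalf_image_univ`) with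
Jacobian `4 e^{2t}` (`det_iwasawaHalfDeriv`), and it carries the density `e^{-2t} ds dt` to the
HYPERBOLIC AREA `dx dy / (4 x²)` of the half-plane (`halfMeasure`): **`w_* iwasawaDensity = halfMeasure`**
(`map_iwasawaHalf_iwasawaDensity`; the change-of-variables theorem composed with the density
transfer `map f (ν.withDensity (g ∘ f)) = (map f ν).withDensity g` along a measurable embedding,
`map_withDensity_comp`). Hence the CAYLEY TRANSFORM `w ↦ (w - 1)/(w + 1)` carries the hyperbolic area
of the half-plane to the Poincaré measure of the disc: **`(cayleyDisc)_* halfMeasure = poincare`**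
(`map_cayleyDisc_halfMeasure`; with `T5SU11MeasurePreserving.map_iwasawaOrbit_iwasawaDensity`), and
`∫_𝔻 G dpoincare = ∫_{Re w > 0} G((w - 1)/(w + 1)) dx dy / (4 x²)` for every a.e.-strongly measurable
`G` (`integral_poincare_halfPlane`). Nothing is claimed about (N).

Blind lane: Mathlib + the HodgeRepro2 prefix only; no sorry; axioms ⊆ {propext, Classical.choice,
Quot.sound}.
-/

namespace Summit.Ventures.HodgeRepro2.T5SU11HalfPlaneMeasure

open MeasureTheory MeasureTheory.Measure Metric Set Filter Topology Complex
open T5PoincareDensity T5PoincareMeasure T5SU11Unimodular T5SU11Fibration T5SU11FibrationHaar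
  T5SU11IwasawaHaar T5SU11IwasawaMeasure T5SU11MeasurePreserving
open scoped ENNReal NNReal Real

/-! ### Density transfer along a measurable embedding -/

/-- `map f (ν.withDensity (g ∘ f)) = (map f ν).withDensity g` for a measurable embedding `f`. -/
theorem map_withDensity_comp {α β : Type*} [MeasurableSpace α] [MeasurableSpace β] {f : α → β}
    (hf : MeasurableEmbedding f) (ν : Measure α) (g : β → ℝ≥0∞) :
    Measure.map f (ν.withDensity (g ∘ f)) = (Measure.map f ν).withDensity g := by
  ext s hs
  rw [hf.map_apply, withDensity_apply _ (hf.measurable hs), withDensity_apply _ hs,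
    hf.restrict_map, hf.lintegral_map]
  rfl

/-! ### The half-plane coordinate `w(ζ) = e^{2t} - 2is` -/

/-- The right half-plane `{Re w > 0}`. -/
def rightHalf : Set ℂ := {w : ℂ | 0 < w.re}

/-- `rightHalf` is open. -/
lemma isOpen_rightHalf : IsOpen rightHalf := isOpen_lt continuous_const Complex.continuous_re

/-- `rightHalf` is measurable. -/
lemma measurableSet_rightHalf : MeasurableSet rightHalf := isOpen_rightHalf.measurableSet

/-- **The hyperbolic area measure of the right half-plane**: `dx dy / (4 x²)` on `{Re w > 0}`. -/
noncomputable def halfMeasure : Measure ℂ :=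
  (volume.restrict rightHalf).withDensity fun w => ENNReal.ofReal (1 / (4 * w.re ^ 2))

/-- `w(ζ) = e^{2 Im ζ} - 2 (Re ζ) i` is injective. -/
lemma iwasawaHalf_injective : Function.Injective iwasawaHalf := by
  intro ζ ζ' h
  have h1 := congrArg Complex.re h
  have h2 := congrArg Complex.im h
  rw [iwasawaHalf_re, iwasawaHalf_re] at h1
  rw [iwasawaHalf_im, iwasawaHalf_im] at h2
  have ht : ζ.im = ζ'.im := by
    have := Real.exp_injective h1
    linarith
  exact Complex.ext (by linarith) ht

/-- `w(ζ)` lies in the right half-plane. -/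
lemma iwasawaHalf_mem_rightHalf (ζ : ℂ) : iwasawaHalf ζ ∈ rightHalf := by
  show 0 < (iwasawaHalf ζ).re
  rw [iwasawaHalf_re]
  exact Real.exp_pos _

/-- `w : ℂ → {Re w > 0}` is onto: `w = w(ζ)` for `ζ = -Im w / 2 + i (log Re w) / 2`. -/
lemma iwasawaHalf_image_univ : iwasawaHalf '' Set.univ = rightHalf := by
  apply Set.Subset.antisymm
  · rintro _ ⟨ζ, -, rfl⟩
    exact iwasawaHalf_mem_rightHalf ζ
  · intro w hw
    refine ⟨⟨-w.im / 2, Real.log w.re / 2⟩, Set.mem_univ _, ?_⟩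
    apply Complex.ext
    · rw [iwasawaHalf_re]
      simp only
      rw [show 2 * (Real.log w.re / 2) = Real.log w.re by ring, Real.exp_log hw]
    · rw [iwasawaHalf_im]
      simp only
      ring

/-- `w` is continuous. -/
lemma continuous_iwasawaHalf : Continuous iwasawaHalf :=
  continuous_iff_continuousAt.2 fun ζ => (hasFDerivAt_iwasawaHalf ζ).continuousAt

/-- `w` is a measurable embedding (continuous and injective on the Polish space `ℂ`). -/
lemma measurableEmbedding_iwasawaHalf : MeasurableEmbedding iwasawaHalf :=
  continuous_iwasawaHalf.measurableEmbedding iwasawaHalf_injective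

/-! ### `w_* (e^{-2t} ds dt) = dx dy / (4 x²)` -/

/-- The Jacobian step: `w_* (4 e^{2t} ds dt) = dx dy` on the right half-plane. -/
lemma map_iwasawaHalf_jacobian :
    Measure.map iwasawaHalf (volume.withDensity fun ζ => ENNReal.ofReal (4 * Real.exp (2 * ζ.im))) =
      volume.restrict rightHalf := by
  have h := map_withDensity_abs_det_fderiv_eq_addHaar (volume : Measure ℂ)
    MeasurableSet.univ.nullMeasurableSet
    (fun ζ _ => (hasFDerivAt_iwasawaHalf ζ).hasFDerivWithinAt) iwasawaHalf_injective.injOn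
  simp only [det_iwasawaHalfDeriv, abs_of_pos (by positivity : (0 : ℝ) < 4 * Real.exp _),
    Measure.restrict_univ, iwasawaHalf_image_univ] at h
  exact h

/-- `e^{-2t} ds dt = (4 e^{2t} ds dt) · (1 / (4 (Re w(ζ))²))`: the density factorises through the
Jacobian and the half-plane density. -/
lemma iwasawaDensity_eq_withDensity :
    iwasawaDensity = (volume.withDensity fun ζ => ENNReal.ofReal (4 * Real.exp (2 * ζ.im))).withDensity
      ((fun w : ℂ => ENNReal.ofReal (1 / (4 * w.re ^ 2))) ∘ iwasawaHalf) := by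
  rw [iwasawaDensity, ← withDensity_mul _ (by fun_prop) (by fun_prop)]
  congr 1
  funext ζ
  rw [Pi.mul_apply, Function.comp_apply, iwasawaHalf_re, ← ENNReal.ofReal_mul (by positivity)]
  congr 1
  have h : Real.exp (2 * ζ.im) ≠ 0 := (Real.exp_pos _).ne'
  rw [Real.exp_neg]
  field_simp

/-- **`w_* (e^{-2t} ds dt) = dx dy / (4 x²)`**: the Iwasawa density is carried to the hyperbolic area
of the right half-plane. -/
theorem map_iwasawaHalf_iwasawaDensity : Measure.map iwasawaHalf iwasawaDensity = halfMeasure := by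
  rw [iwasawaDensity_eq_withDensity, map_withDensity_comp measurableEmbedding_iwasawaHalf,
    map_iwasawaHalf_jacobian]
  rfl

/-- `ζ ↦ w(ζ)` is measure preserving from `e^{-2t} ds dt` to `dx dy / (4 x²)`. -/
theorem measurePreserving_iwasawaHalf : MeasurePreserving iwasawaHalf iwasawaDensity halfMeasure :=
  ⟨continuous_iwasawaHalf.measurable, map_iwasawaHalf_iwasawaDensity⟩

/-! ### The Cayley transform carries the half-plane area to the Poincaré measure -/

/-- `cayleyDisc` is measurable. -/
lemma measurable_cayleyDisc : Measurable cayleyDisc :=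
  (measurable_id.sub_const 1).div (measurable_id.add_const 1)

/-- `iwasawaOrbit = cayleyDisc ∘ iwasawaHalf`. -/
lemma iwasawaOrbit_eq_comp : iwasawaOrbit = cayleyDisc ∘ iwasawaHalf := funext iwasawaOrbit_eq

section measure

variable [MeasurableSpace Circle] [BorelSpace Circle]

/-- **The Cayley transform `w ↦ (w - 1)/(w + 1)` carries the hyperbolic area of the right half-plane
to the Poincaré measure of the disc**: `(cayleyDisc)_* halfMeasure = poincare`. -/
theorem map_cayleyDisc_halfMeasure : Measure.map cayleyDisc halfMeasure = poincare := by
  rw [← map_iwasawaHalf_iwasawaDensity,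
    Measure.map_map measurable_cayleyDisc continuous_iwasawaHalf.measurable, ← iwasawaOrbit_eq_comp,
    map_iwasawaOrbit_iwasawaDensity]

/-- `cayleyDisc` is measure preserving from `dx dy / (4 x²)` to `poincare`. -/
theorem measurePreserving_cayleyDisc : MeasurePreserving cayleyDisc halfMeasure poincare :=
  ⟨measurable_cayleyDisc, map_cayleyDisc_halfMeasure⟩

/-- **`∫_𝔻 G dpoincare = ∫_{Re w > 0} G((w - 1)/(w + 1)) dx dy / (4 x²)`** for every a.e.-strongly
measurable `G`. -/
theorem integral_poincare_halfPlane {E : Type*} [NormedAddCommGroup E] [NormedSpace ℝ E] (G : ℂ → E)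
    (hG : AEStronglyMeasurable G poincare) :
    ∫ z, G z ∂poincare = ∫ w, G (cayleyDisc w) ∂halfMeasure := by
  have hG' : AEStronglyMeasurable G (Measure.map cayleyDisc halfMeasure) := by
    rw [map_cayleyDisc_halfMeasure]
    exact hG
  rw [← map_cayleyDisc_halfMeasure, integral_map measurable_cayleyDisc.aemeasurable hG']

end measure

end Summit.Ventures.HodgeRepro2.T5SU11HalfPlaneMeasure
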